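import Literature.MathematicalPhysics.QuantumLattice.CuprateAxialOrbitalDownfold

/-!
# The range of the cuprate `t–t′–t″` one-band dispersion: when is the bandwidth exactly `8t`?

For the square-lattice one-band dispersion of [PavariniEtAl2001, Eq. (1)],
`ε(k) = −2t(cos kₓ + cos k_y) + 4t′ cos kₓ cos k_y − 2t″(cos 2kₓ + cos 2k_y)` (hopping integrals
`t, t′, t″ ≥ 0` in that convention; the tree's `CuprateFourOrbital.pavariniBand`), the corner values are
`ε(Γ) = −4t + 4t′ − 4t″`, `ε(M) = 4t + 4t′ − 4t″`, `ε(X) = ε(Y) = −4t′ − 4t″`, so that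
`ε(M) − ε(Γ) = 8t` whatever `t′, t″` (they cancel between `Γ = (0,0)` and `M = (π,π)`), while the
saddle-point (van Hove) level `ε(X)` sits `4t − 8t′` above the bottom and `4t + 8t′` below the top.
The review literature measures the Hubbard `U` of the cuprates against "the bandwidth … `W ≃ 8t`"
[ArovasBergKivelsonRaghu2022, §6 p. 33 (arXiv p0033) and the `U/8t` axis of §5].  What is proved
here is the exact domain statement behind that usage: **if `0 ≤ t′ ≤ t/2` and `0 ≤ t″ ≤ t/4` then
`ε(Γ) ≤ ε(k) ≤ ε(M)` for every `k`**, so the band range is `[ε(Γ), ε(M)]` and the width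
`sup ε − inf ε` is exactly `8t`, independent of `t′` and `t″` (`band_mem_Icc`, `band_osc_le`,
`width_eq`); and both hypotheses are sharp in the sense that `t″ > t/4` (with `t′ = 0`) moves the
maximum off `M` and `t′ > t/2` (with `t″ = 0`) moves the minimum off `Γ` (`top_leaves_M_example`,
`bottom_leaves_Gamma_example`).  Every cuprate one-band row the cell holds (`t′/t ∈ [0.05, 0.33]`,
`t″/t ∈ [0, 0.22]`) lies inside the domain.  No facts, no numbers of record.

References: E. Pavarini, I. Dasgupta, T. Saha-Dasgupta, O. Jepsen, O. K. Andersen, Phys. Rev. Lett. 87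
(2001) 047003, Eq. (1) · D. P. Arovas, E. Berg, S. A. Kivelson, S. Raghu, *The Hubbard Model*, Annu.
Rev. Condens. Matter Phys. 13 (2022) 239, arXiv:2103.12097, §§5–6 ("Taking W ≃ 8t").  AI-produced
formalisation (H21, cell hubbard-downfold, seat lit-1, 2026-08-27); no facts, no axioms beyond
Mathlib's, no `sorry`.
-/

noncomputable section

namespace Literature.MathematicalPhysics.QuantumLattice

namespace CuprateOneBandRange

open Real CuprateFourOrbital

/-! ## §1 Corner values -/

/-- `ε(Γ) = ε(0,0) = −4t + 4t′ − 4t″`. [cite: PavariniEtAl2001, Eq. (1)] -/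
theorem band_Gamma (t t' t'' : ℝ) : pavariniBand t t' t'' 0 0 = -4 * t + 4 * t' - 4 * t'' := by
  unfold pavariniBand
  rw [mul_zero, Real.cos_zero]
  ring

/-- `ε(M) = ε(π,π) = 4t + 4t′ − 4t″`. [cite: PavariniEtAl2001, Eq. (1)] -/
theorem band_M (t t' t'' : ℝ) : pavariniBand t t' t'' π π = 4 * t + 4 * t' - 4 * t'' := by
  unfold pavariniBand
  rw [Real.cos_pi, show (2 : ℝ) * π = 0 + 2 * π by ring, Real.cos_add_two_pi, Real.cos_zero]
  ring

/-- `ε(X) = ε(π,0) = −4t′ − 4t″` (the saddle-point / van Hove level). [cite: PavariniEtAl2001, Eq. (1)] -/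
theorem band_X (t t' t'' : ℝ) : pavariniBand t t' t'' π 0 = -4 * t' - 4 * t'' := by
  unfold pavariniBand
  rw [Real.cos_pi, mul_zero, Real.cos_zero, show (2 : ℝ) * π = 0 + 2 * π by ring, Real.cos_add_two_pi,
    Real.cos_zero]
  ring

/-- `ε(Y) = ε(0,π) = ε(X)`. [cite: PavariniEtAl2001, Eq. (1)] -/
theorem band_Y (t t' t'' : ℝ) : pavariniBand t t' t'' 0 π = -4 * t' - 4 * t'' := by
  unfold pavariniBand
  rw [Real.cos_pi, mul_zero, Real.cos_zero, show (2 : ℝ) * π = 0 + 2 * π by ring, Real.cos_add_two_pi,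
    Real.cos_zero]
  ring

/-- **`ε(M) − ε(Γ) = 8t`: `t′` and `t″` cancel between `Γ` and `M`.** [cite: ArovasBergKivelsonRaghu2022,
§6 p. 33 ("Taking W ≃ 8t")] -/
theorem band_M_sub_Gamma (t t' t'' : ℝ) : pavariniBand t t' t'' π π - pavariniBand t t' t'' 0 0 = 8 * t := by
  rw [band_M, band_Gamma]
  ring

/-- The van Hove level sits `4t − 8t′` above the bottom … [cite: PavariniEtAl2001, Eq. (1)] -/
theorem band_X_sub_Gamma (t t' t'' : ℝ) :
    pavariniBand t t' t'' π 0 - pavariniBand t t' t'' 0 0 = 4 * t - 8 * t' := by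
  rw [band_X, band_Gamma]
  ring

/-- … and `4t + 8t′` below the top: `t′` skews the band about the saddle point by `16t′` without changing
`ε(M) − ε(Γ)`. [cite: PavariniEtAl2001, Eq. (1)] -/
theorem band_M_sub_X (t t' t'' : ℝ) :
    pavariniBand t t' t'' π π - pavariniBand t t' t'' π 0 = 4 * t + 8 * t' := by
  rw [band_M, band_X]
  ring

/-! ## §2 The range theorem: `ε(Γ) ≤ ε(k) ≤ ε(M)` for `0 ≤ t′ ≤ t/2`, `0 ≤ t″ ≤ t/4` -/

/-- The dispersion as a polynomial in `c = cos kₓ`, `d = cos k_y`: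
`ε = −2t(c + d) + 4t′cd − 2t″(2c² + 2d² − 2)`. [cite: PavariniEtAl2001, Eq. (1)] -/
theorem band_eq_poly (t t' t'' kx ky : ℝ) :
    pavariniBand t t' t'' kx ky
      = -2 * t * (cos kx + cos ky) + 4 * t' * (cos kx * cos ky)
          - 2 * t'' * (2 * cos kx ^ 2 + 2 * cos ky ^ 2 - 2) := by
  unfold pavariniBand
  rw [Real.cos_two_mul, Real.cos_two_mul]
  ring

/-- **Upper edge**: for `0 ≤ t′` and `0 ≤ t″ ≤ t/4` the band never exceeds its `M`-point value.
(Proof: with `u = 1 + cos kₓ`, `v = 1 + cos k_y ∈ [0, 2]`,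
`ε(M) − ε(k) = (2t − 8t″)(u + v) + 2t′[(2 − v)u + (2 − u)v] + 4t″(u² + v²) ≥ 0`.)
[cite: ArovasBergKivelsonRaghu2022, §6 p. 33 ("W ≃ 8t")] -/
theorem band_le_M (t t' t'' kx ky : ℝ) (ht' : 0 ≤ t') (ht'' : 0 ≤ t'') (h4 : 4 * t'' ≤ t) :
    pavariniBand t t' t'' kx ky ≤ pavariniBand t t' t'' π π := by
  rw [band_eq_poly, band_M]
  set c := cos kx with hc
  set d := cos ky with hd
  have hc1 : c ≤ 1 := cos_le_one kx
  have hc2 : -1 ≤ c := neg_one_le_cos kx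
  have hd1 : d ≤ 1 := cos_le_one ky
  have hd2 : -1 ≤ d := neg_one_le_cos ky
  have h1 : 0 ≤ (1 - d) * (1 + c) := mul_nonneg (by linarith) (by linarith)
  have h2 : 0 ≤ (1 - c) * (1 + d) := mul_nonneg (by linarith) (by linarith)
  have h3 : 0 ≤ (t - 4 * t'') * (1 + c) := mul_nonneg (by linarith) (by linarith)
  have h4' : 0 ≤ (t - 4 * t'') * (1 + d) := mul_nonneg (by linarith) (by linarith)
  nlinarith [mul_nonneg ht' h1, mul_nonneg ht' h2, mul_nonneg ht'' (sq_nonneg (1 + c)),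
    mul_nonneg ht'' (sq_nonneg (1 + d))]

/-- **Lower edge**: for `0 ≤ t′ ≤ t/2` and `0 ≤ t″` the band never drops below its `Γ`-point value.
(Proof: with `p = 1 − cos kₓ`, `q = 1 − cos k_y ∈ [0, 2]`,
`ε(k) − ε(Γ) = (2t − 4t′)(p + q) + 4t′pq + 4t″[p(2 − p) + q(2 − q)] ≥ 0`.)
[cite: ArovasBergKivelsonRaghu2022, §6 p. 33 ("W ≃ 8t")] -/
theorem band_ge_Gamma (t t' t'' kx ky : ℝ) (ht' : 0 ≤ t') (h2 : 2 * t' ≤ t) (ht'' : 0 ≤ t'') :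
    pavariniBand t t' t'' 0 0 ≤ pavariniBand t t' t'' kx ky := by
  rw [band_Gamma, band_eq_poly]
  set c := cos kx with hc
  set d := cos ky with hd
  have hc1 : c ≤ 1 := cos_le_one kx
  have hc2 : -1 ≤ c := neg_one_le_cos kx
  have hd1 : d ≤ 1 := cos_le_one ky
  have hd2 : -1 ≤ d := neg_one_le_cos ky
  have hpq : 0 ≤ (1 - c) * (1 - d) := mul_nonneg (by linarith) (by linarith)
  have hp : 0 ≤ (1 - c) * (1 + c) := mul_nonneg (by linarith) (by linarith)
  have hq : 0 ≤ (1 - d) * (1 + d) := mul_nonneg (by linarith) (by linarith)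
  have h3 : 0 ≤ (t - 2 * t') * (1 - c) := mul_nonneg (by linarith) (by linarith)
  have h4 : 0 ≤ (t - 2 * t') * (1 - d) := mul_nonneg (by linarith) (by linarith)
  nlinarith [mul_nonneg ht' hpq, mul_nonneg ht'' hp, mul_nonneg ht'' hq]

/-- **The band range is `[ε(Γ), ε(M)]`** on the domain `0 ≤ t′ ≤ t/2`, `0 ≤ t″ ≤ t/4`.
[cite: ArovasBergKivelsonRaghu2022, §6 p. 33 ("W ≃ 8t")] -/
theorem band_mem_Icc (t t' t'' kx ky : ℝ) (ht' : 0 ≤ t') (h2 : 2 * t' ≤ t) (ht'' : 0 ≤ t'')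
    (h4 : 4 * t'' ≤ t) :
    pavariniBand t t' t'' kx ky ∈ Set.Icc (pavariniBand t t' t'' 0 0) (pavariniBand t t' t'' π π) :=
  ⟨band_ge_Gamma t t' t'' kx ky ht' h2 ht'', band_le_M t t' t'' kx ky ht' ht'' h4⟩

/-- **Bandwidth `8t`**: on that domain any two band energies differ by at most `8t` …
[cite: ArovasBergKivelsonRaghu2022, §6 p. 33 ("Taking W ≃ 8t")] -/
theorem band_osc_le (t t' t'' kx ky kx' ky' : ℝ) (ht' : 0 ≤ t') (h2 : 2 * t' ≤ t) (ht'' : 0 ≤ t'')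
    (h4 : 4 * t'' ≤ t) :
    pavariniBand t t' t'' kx ky - pavariniBand t t' t'' kx' ky' ≤ 8 * t := by
  have ha := band_le_M t t' t'' kx ky ht' ht'' h4
  have hb := band_ge_Gamma t t' t'' kx' ky' ht' h2 ht''
  have hw := band_M_sub_Gamma t t' t''
  linarith

/-- … and `8t` is attained (between `M` and `Γ`), so the width `max ε − min ε` is EXACTLY `8t`,
independent of `t′` and `t″`. [cite: ArovasBergKivelsonRaghu2022, §6 p. 33 ("Taking W ≃ 8t")] -/
theorem width_eq (t t' t'' : ℝ) (ht' : 0 ≤ t') (h2 : 2 * t' ≤ t) (ht'' : 0 ≤ t'') (h4 : 4 * t'' ≤ t) :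
    IsGreatest {w : ℝ | ∃ kx ky kx' ky' : ℝ,
        w = pavariniBand t t' t'' kx ky - pavariniBand t t' t'' kx' ky'} (8 * t) := by
  refine ⟨⟨π, π, 0, 0, (band_M_sub_Gamma t t' t'').symm⟩, ?_⟩
  rintro w ⟨kx, ky, kx', ky', rfl⟩
  exact band_osc_le t t' t'' kx ky kx' ky' ht' h2 ht'' h4

/-- In units of `t`: with `t > 0`, `r′ = t′/t ∈ [0, ½]`, `r″ = t″/t ∈ [0, ¼]` the hypotheses hold — the form
in which the cell's rows (`|t′/t| ≤ 0.33`, `t″/t ≤ 0.22`) are checked. [cite: PavariniEtAl2001, Eq. (1)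
and p. 3 (`r ≈ t′/t`, `t″ ≈ t′/2`)] -/
theorem hyp_of_ratios (t r' r'' : ℝ) (ht : 0 < t) (h1 : 0 ≤ r') (h2 : r' ≤ 1 / 2) (h3 : 0 ≤ r'')
    (h4 : r'' ≤ 1 / 4) :
    0 ≤ r' * t ∧ 2 * (r' * t) ≤ t ∧ 0 ≤ r'' * t ∧ 4 * (r'' * t) ≤ t := by
  refine ⟨by positivity, by nlinarith, by positivity, by nlinarith⟩

/-! ## §3 Sharpness of the two hypotheses -/

/-- `cos(2π/3) = −1/2`, written as `cos(π − π/3)`. [cite: PavariniEtAl2001, Eq. (1)] -/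
private theorem cos_two_pi_div_three' : cos (π - π / 3) = -(1 / 2) := by
  rw [Real.cos_pi_sub, Real.cos_pi_div_three]

/-- **`t″ ≤ t/4` is sharp**: for `t = 1`, `t′ = 0`, `t″ = ½` the value at `(2π/3, 2π/3)` is `3`, above
`ε(M) = 2` — the top of the band has left `M`. [cite: PavariniEtAl2001, Eq. (1)] -/
theorem top_leaves_M_example :
    pavariniBand 1 0 (1 / 2) π π < pavariniBand 1 0 (1 / 2) (π - π / 3) (π - π / 3) := by
  rw [band_M, band_eq_poly, cos_two_pi_div_three']
  norm_num

/-- **`t′ ≤ t/2` is sharp**: for `t = 1`, `t′ = 1`, `t″ = 0` the value at `X` is `−4`, below `ε(Γ) = 0` —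
the bottom of the band has left `Γ`. [cite: PavariniEtAl2001, Eq. (1)] -/
theorem bottom_leaves_Gamma_example : pavariniBand 1 1 0 π 0 < pavariniBand 1 1 0 0 0 := by
  rw [band_X, band_Gamma]
  norm_num

end CuprateOneBandRange

end Literature.MathematicalPhysics.QuantumLattice
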